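import Summits.QuantumFields.BalabanUV.T4Continuum.Support.RegionGaugeFixedVector
import Summits.QuantumFields.BalabanUV.Beta.GAN24.MonotoneTorusHodge

/-!
# T⁴ programme, spine node NE2 (U1a), sub-row Δ1 «NE2⁰-Dirichlet» — THE FLATNESS LEMMA FOR THE [B9]-FAITHFUL `U = 1` REGION VECTOR
# OPERATOR, HENCE «`G(Ω₀) = (Δ_a↾Ω₀)⁻¹` EXISTS» UNCONDITIONALLY ON EVERY UNION OF UNIT BLOCKS (positivity, no uniformity)

NE2 formalisation swarm `b2b-balaban-t4-ne2-formalise-*`, leaf 07 (gen 5), supplier item «Δ1-COERC», file 4 (files 1–3: `RegionGaugeSlice`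
p222530, `RegionScalarCompression` p222542, `RegionGaugeFixedVector` p223093).  [Balaban1985BackgroundPropagators] p. 395: «Assuming some
regularity of the configuration U it can be easily shown that the operator Δ′_a is positive. This implies positivity of the operators G′,
Q′G′²Q′*, hence the existence of the operator R», then (3.26)–(3.27) «Δ_a = Δ + DRD* + Q*aQ … G(U) = G = (Δ_a↾Ω₀)⁻¹».  File 1 reduced the
POSITIVITY of the gauge-fixed vector operator to the FLATNESS LEMMA «a curl-free field with zero block averages is a pure gauge `Dλ`,
`λ ∈ N(Q′)`» (`RegionGaugeSlice.isUnit_det_gaugeFixed_of_flat`).  THIS FILE PROVES the flatness lemma for the typed instance of file 3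
(`U = 1`, ONE region `Ω = blockReg n M S` — ANY decidable set `S` of unit blocks —, star bonds), hence the EXISTENCE of `G(Ω₀)` with no
displayed hypothesis:

 * §1 reading on the star bonds = acting on the zero-extension (`submatrix_mulVec_eq`), so `curlR A = 0` makes every torus plaquette of
   the extension vanish and `avgR A = 0` is `Q(ext A) = 0`;
 * §2 block geometry: `bpt (blockOf x) (digits x) = x`, a unit step stays in the block or enters the next one (`blockOf_add_unitVec`),
   and a function with vanishing differences along the bonds INSIDE a block is constant on the block (`const_on_block`, induction on the
   digit sum);
 * §3 **`flat_region`**: `curlR A = 0 → avgR A = 0 → ∃ λ, QOm λ = 0 ∧ A = gradR λ`.  Proof: the torus Poincaré lemma (road P4's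
   `MonotoneTorusHodge.exists_potential_of_plaq_eq_zero`: `ext A = dφ + h`), «Q∂ = ∂₁Q′» and `Q(const) = const` kill the harmonic part
   (`Σ_y (∂₁Q′φ)(y,μ) = 0` forces `h = 0`) and make the block averages `Q′φ` translation invariant; subtracting the block-constant lift
   `Q′φ ∘ blockOf` (whose bond differences vanish) gives a potential `θ` with the same differences, and `θ = 0` on every block outside `S`
   because `ext A` vanishes on the bonds inside such a block (so `φ` is constant there and equals its block average); `λ = n⁻¹·θ|_Ω`.
 * §4 **`isUnit_det_regionDeltaA (ha : 0 < a) (ha′ : 0 < a′) : IsUnit (regionDeltaA n M a a′ S).det`** — «G(Ω₀) exists» for the faithful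
   `U = 1` operator on EVERY union of unit blocks, by file 1's `isUnit_det_gaugeFixed_of_flat`.  NO bound on `‖G(Ω₀)‖` is claimed here
   (that is file 3's `opNorm_inv_regionDeltaA_le_of_slice`, from the displayed slice inequality).

HONEST FRAMING (T4-DAG p. 1).  [folklore] lattice bookkeeping + road P4's torus Poincaré lemma BY NAME; model level (`U = 1`, one region,
one scale, star bonds); statements OURS; nothing printed is a hypothesis; NOT [B9] (3.23)–(3.27) as printed (no background field, no
`{Λ_j}`); NE2 (U1a) NOT proved; spine 0/9 unchanged; NOT infinite volume / mass gap / Clay / summit progress.  HONEST DEPENDENCY: continuum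
YM on T⁴ ⇐ BetaPertH ∧ nine spine estimates (0/9 proved); BetaPertH ⇐ (D1) ∧ (D4) ∧ CAP+tail; G-an2-4 gates asym, D1 and NE2/3/4.  No `sorry`.
-/

noncomputable section

open scoped BigOperators ComplexConjugate Matrix Matrix.Norms.L2Operator
open Finset

namespace Summit.QuantumFields.BalabanUV.T4Continuum.RegionGaugeFixedVectorFlat

open Literature.MathematicalPhysics.QuantumFieldTheory.Balaban1983to89.B5Prop11Plancherel (Tor fine unitVec)
open Literature.MathematicalPhysics.QuantumFieldTheory.Balaban1983to89.B5Prop11Lower (nsq)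
open Literature.MathematicalPhysics.QuantumFieldTheory.Balaban1983to89.B5Action121 (GradOp GradOp_mulVec sdiff_mulVec CurlOp CurlOp_mulVec gaugeT)
open Literature.MathematicalPhysics.QuantumFieldTheory.Balaban1983to89.B5Block118 (bpt QsOp QvOp QsOp_mulVec QvOp_gaugeT_eq)
open Literature.MathematicalPhysics.QuantumFieldTheory.Balaban1983to89.B5Blocks16 (blockOf blockOf_bpt bpt_bijective)
open Literature.MathematicalPhysics.QuantumFieldTheory.Balaban1983to89.B5AverageCurlStokes (plaq Fs_eq_mul_plaq)
open Summit.QuantumFields.BalabanUV.T4Continuum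
open Summit.QuantumFields.BalabanUV.T4Continuum.SubtypeCompression (ext ext_apply_of ext_apply_of_not)
open Summit.QuantumFields.BalabanUV.T4Continuum.ScalarBlockTrialFunction (digits digits_bpt bpt_add_unitVec_of_lt bpt_add_unitVec_of_eq)
open Summit.QuantumFields.BalabanUV.T4Continuum.RegionGaugeSlice (isUnit_det_gaugeFixed_of_flat)
open Summit.QuantumFields.BalabanUV.T4Continuum.RegionScalarCompression (QOm GOm)
open Summit.QuantumFields.BalabanUV.T4Continuum.RegionGaugeFixedVector (starReg curlR gradR avgR grad₁R regionDeltaA sliceData_region)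
open Summit.QuantumFields.BalabanUV.Beta.GAN24.DirichletBoxCompression (DOm toBlock_mulVec')
open Summit.QuantumFields.BalabanUV.Beta.GAN24.DirichletBoxTrace (blockReg)
open Summit.QuantumFields.BalabanUV.Beta.GAN24.MonotoneTorusHodge (exists_potential_of_plaq_eq_zero QvOp_mulVec_const sum_gradOp_eq_zero)

variable {d : ℕ} (n : ℕ) [NeZero n] (M : Fin d → ℕ) [hM : ∀ μ, NeZero (M μ)] (a a' : ℝ) (S : Tor M → Prop) [DecidablePred S]

/-! ## §1 Reading on the star bonds is acting on the zero-extension -/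

/-- `X|_{·V}·A = X·(ext A)`. [folklore] -/
theorem submatrix_mulVec_eq {α : Type*} (X : Matrix α (Tor (fine n M) × Fin d) ℂ) (A : {b // starReg n M S b} → ℂ) :
    X.submatrix id Subtype.val *ᵥ A = X *ᵥ ext (starReg n M S) A := by
  funext i
  simp only [Matrix.mulVec, dotProduct, Matrix.submatrix_apply, id]
  rw [← Fintype.sum_subtype_add_sum_subtype (starReg n M S) (fun b => X i b * ext (starReg n M S) A b)]
  have h2 : ∑ b : {b // ¬ starReg n M S b}, X i b * ext (starReg n M S) A b = 0 :=
    Finset.sum_eq_zero fun b _ => by rw [ext_apply_of_not _ _ b.2, mul_zero]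
  rw [h2, add_zero]
  exact Finset.sum_congr rfl fun b _ => by rw [ext_apply_of]

/-- `curlR A = 0` ⟹ every torus plaquette of the zero-extension vanishes. [folklore] -/
theorem plaq_ext_eq_zero (A : {b // starReg n M S b} → ℂ) (hC : curlR n M S *ᵥ A = 0) (μ ν : Fin d) (x : Tor (fine n M)) :
    plaq (fine n M) (ext (starReg n M S) A) μ ν x = 0 := by
  have hn : (n : ℂ) ≠ 0 := by exact_mod_cast NeZero.ne n
  have hs : ((((Real.sqrt 2)⁻¹ : ℝ) : ℂ)) ≠ 0 := by
    exact_mod_cast (inv_ne_zero (Real.sqrt_ne_zero'.mpr (by norm_num)))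
  have h1 : CurlOp (fine n M) (n : ℂ) *ᵥ ext (starReg n M S) A = 0 := by
    have h := hC
    unfold curlR at h
    rw [Matrix.smul_mulVec, submatrix_mulVec_eq] at h
    exact (smul_eq_zero.mp h).resolve_left hs
  have h2 := congrFun h1 (x, (μ, ν))
  rw [CurlOp_mulVec, Fs_eq_mul_plaq, Pi.zero_apply] at h2
  exact (mul_eq_zero.mp h2).resolve_left hn

/-- `avgR A = Q·(ext A)`. [folklore] -/
theorem avgR_mulVec (A : {b // starReg n M S b} → ℂ) : avgR n M S *ᵥ A = QvOp n M *ᵥ ext (starReg n M S) A :=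
  submatrix_mulVec_eq n M S (QvOp n M) A

/-! ## §2 Block geometry -/

/-- every fine site is `n·(blockOf x) + digits x`. [folklore] -/
theorem bpt_blockOf_digits (x : Tor (fine n M)) : bpt n M (blockOf n M x) (digits n M x) = x := by
  unfold blockOf digits
  exact (Equiv.ofBijective _ (bpt_bijective n M)).apply_symm_apply x

/-- a unit step stays in the block or enters the next block. [folklore] -/
theorem blockOf_add_unitVec (x : Tor (fine n M)) (ν : Fin d) :
    blockOf n M (x + unitVec (fine n M) ν) = blockOf n M x ∨ blockOf n M (x + unitVec (fine n M) ν) = blockOf n M x + unitVec M ν := by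
  set y := blockOf n M x
  set j := digits n M x
  have hx : x = bpt n M y j := (bpt_blockOf_digits n M x).symm
  by_cases h : (j ν : ℕ) + 1 < n
  · left; rw [hx, bpt_add_unitVec_of_lt n M y j ν h, blockOf_bpt]
  · right
    have he : (j ν : ℕ) + 1 = n := by have := (j ν).isLt; omega
    rw [hx, bpt_add_unitVec_of_eq n M y j ν he, blockOf_bpt]

/-- **a function whose differences vanish along the bonds INSIDE the block `y` is constant on the block** (induction on the digit sum).
[folklore] -/
theorem const_on_block (φ : Tor (fine n M) → ℂ) (y : Tor M)
    (hφ : ∀ (x : Tor (fine n M)) (ν : Fin d), blockOf n M x = y → blockOf n M (x + unitVec (fine n M) ν) = y →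
      φ (x + unitVec (fine n M) ν) = φ x)
    (j : Fin d → Fin n) : φ (bpt n M y j) = φ (bpt n M y (fun _ => ⟨0, Nat.pos_of_ne_zero (NeZero.ne n)⟩)) := by
  -- lowering one digit by one step does not change the value
  have step : ∀ (j : Fin d → Fin n) (ν : Fin d) (h : (j ν : ℕ) + 1 < n),
      φ (bpt n M y (Function.update j ν ⟨(j ν : ℕ) + 1, h⟩)) = φ (bpt n M y j) := by
    intro j ν h
    rw [← bpt_add_unitVec_of_lt n M y j ν h]
    refine hφ _ ν (blockOf_bpt n M y j) ?_
    rw [bpt_add_unitVec_of_lt n M y j ν h, blockOf_bpt]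
  -- strong induction on the digit sum
  suffices H : ∀ (m : ℕ) (j : Fin d → Fin n), (∑ ν, (j ν : ℕ)) = m →
      φ (bpt n M y j) = φ (bpt n M y (fun _ => ⟨0, Nat.pos_of_ne_zero (NeZero.ne n)⟩)) from H _ j rfl
  intro m
  induction m using Nat.strong_induction_on with
  | _ m ih =>
    intro j hj
    by_cases h0 : ∃ ν, (j ν : ℕ) ≠ 0
    swap
    · have h0' : ∀ ν, (j ν : ℕ) = 0 := fun ν => by by_contra hne; exact h0 ⟨ν, hne⟩
      have : j = fun _ => ⟨0, Nat.pos_of_ne_zero (NeZero.ne n)⟩ := funext fun ν => Fin.ext (h0' ν)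
      rw [this]
    · obtain ⟨ν, hν⟩ := h0
      -- the predecessor digit vector
      set k : ℕ := (j ν : ℕ) - 1 with hk
      have hk1 : k + 1 = (j ν : ℕ) := by omega
      have hkn : k < n := by have := (j ν).isLt; omega
      set j' : Fin d → Fin n := Function.update j ν ⟨k, hkn⟩ with hj'
      have hj'ν : (j' ν : ℕ) = k := by simp [hj']
      have hlt : (j' ν : ℕ) + 1 < n := by rw [hj'ν, hk1]; exact (j ν).isLt
      have hback : Function.update j' ν ⟨(j' ν : ℕ) + 1, hlt⟩ = j := by
        funext μ
        by_cases hμ : μ = ν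
        · subst hμ; rw [Function.update_self]; exact Fin.ext (by show (j' μ : ℕ) + 1 = (j μ : ℕ); omega)
        · simp [hj', Function.update_of_ne hμ]
      have e1 : φ (bpt n M y j) = φ (bpt n M y j') := by rw [← hback, step j' ν hlt]
      -- digit sum drops by one
      have hsum : (∑ μ, (j' μ : ℕ)) + 1 = m := by
        rw [← hj]
        have e2 : ∀ μ, (j' μ : ℕ) = Function.update (fun μ => (j μ : ℕ)) ν k μ := by
          intro μ
          by_cases hμ : μ = ν
          · subst hμ; simp [hj']
          · simp [hj', Function.update_of_ne hμ]
        simp_rw [e2]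
        rw [Finset.sum_update_of_mem (Finset.mem_univ ν), ← Finset.add_sum_erase _ (fun μ => (j μ : ℕ)) (Finset.mem_univ ν),
          Finset.sdiff_singleton_eq_erase]
        omega
      rw [e1]
      exact ih _ (by omega) j' rfl

/-! ## §3 The flatness lemma -/

/-- **THE FLATNESS LEMMA** for the faithful `U = 1` region operator: a star-bond field whose torus curl and unit-block averages vanish is
a PURE GAUGE `gradR λ` with `λ` supported in `Ω` and `Q′λ = 0`. [folklore] -/
theorem flat_region (A : {b // starReg n M S b} → ℂ) (hC : curlR n M S *ᵥ A = 0) (hQ : avgR n M S *ᵥ A = 0) :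
    ∃ lam : {x // blockReg n M S x} → ℂ, QOm n M S *ᵥ lam = 0 ∧ A = gradR n M S *ᵥ lam := by
  classical
  have hn : (n : ℂ) ≠ 0 := by exact_mod_cast NeZero.ne n
  set z := ext (starReg n M S) A with hz
  -- (1) torus Poincaré lemma: `z = dφ + h`
  obtain ⟨φ, h, hφ⟩ := exists_potential_of_plaq_eq_zero (fine n M) z (plaq_ext_eq_zero n M S A hC)
  -- (2) `z = n⁻¹•∂φ + const h`
  have hz2 : z = (n : ℂ)⁻¹ • (GradOp (fine n M) (n : ℂ) *ᵥ φ) + (fun b : Tor (fine n M) × Fin d => h b.2) := by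
    funext ⟨x, μ⟩
    rw [Pi.add_apply, Pi.smul_apply, GradOp_mulVec, sdiff_mulVec, smul_eq_mul, hφ x μ]
    field_simp
  -- (3) `Q z = 0`: `n⁻¹•∂₁(Q′φ) + h = 0`
  set ψ := QsOp n M *ᵥ φ with hψ
  have hQz : (n : ℂ)⁻¹ • (GradOp M 1 *ᵥ ψ) + (fun b : Tor M × Fin d => h b.2) = 0 := by
    have h0 : QvOp n M *ᵥ z = 0 := by rw [hz, ← avgR_mulVec]; exact hQ
    have h155 := QvOp_gaugeT_eq n M 0 φ
    simp only [gaugeT, zero_sub, Matrix.mulVec_neg, Matrix.mulVec_zero, neg_inj] at h155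
    rw [hz2, Matrix.mulVec_add, Matrix.mulVec_smul, h155, QvOp_mulVec_const] at h0
    exact h0
  -- (4) `h = 0` (sum the `μ`-component over the unit torus)
  have hh : ∀ μ, h μ = 0 := by
    intro μ
    have e := congrArg (fun F : Tor M × Fin d → ℂ => ∑ y : Tor M, F (y, μ)) hQz
    simp only [Pi.add_apply, Pi.smul_apply, Pi.zero_apply, smul_eq_mul, Finset.sum_add_distrib, ← Finset.mul_sum,
      sum_gradOp_eq_zero, mul_zero, zero_add, Finset.sum_const, Finset.card_univ, nsmul_eq_mul] at e
    have hc : ((Fintype.card (Tor M) : ℕ) : ℂ) ≠ 0 := by exact_mod_cast Fintype.card_ne_zero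
    exact (mul_eq_zero.mp e).resolve_left hc
  -- (5) `∂₁ψ = 0`: the block averages are translation invariant
  have hψ0 : ∀ (y : Tor M) (μ : Fin d), ψ (y + unitVec M μ) = ψ y := by
    intro y μ
    have e := congrFun hQz (y, μ)
    rw [Pi.add_apply, Pi.smul_apply, hh μ, add_zero, GradOp_mulVec, sdiff_mulVec, one_mul, smul_eq_mul, Pi.zero_apply] at e
    have := (mul_eq_zero.mp e).resolve_left (inv_ne_zero hn)
    exact (sub_eq_zero.mp this)
  -- (6) the block-constant lift `ψ̃ = ψ ∘ blockOf` has vanishing bond differences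
  set ψt : Tor (fine n M) → ℂ := fun x => ψ (blockOf n M x) with hψt
  have hψt0 : ∀ (x : Tor (fine n M)) (ν : Fin d), ψt (x + unitVec (fine n M) ν) = ψt x := by
    intro x ν
    simp only [hψt]
    rcases blockOf_add_unitVec n M x ν with e | e
    · rw [e]
    · rw [e, hψ0]
  -- (7) `θ = φ − ψ̃` has the same differences as `φ`, and `z = θ`-differences (as `h = 0`)
  set θ : Tor (fine n M) → ℂ := fun x => φ x - ψt x with hθ
  have hzθ : ∀ (x : Tor (fine n M)) (μ : Fin d), z (x, μ) = θ (x + unitVec (fine n M) μ) - θ x := by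
    intro x μ
    rw [hφ x μ, hh μ, add_zero]
    simp only [hθ, hψt0]
    ring
  -- (8) `θ = 0` off `Ω`: on a block `y ∉ S`, `z` vanishes on the inside bonds, so `φ` is constant there and equals its average
  have hθ0 : ∀ x : Tor (fine n M), ¬ blockReg n M S x → θ x = 0 := by
    intro x hx
    have hy : ¬ S (blockOf n M x) := hx
    set y := blockOf n M x with hy'
    -- `φ` is constant on the block `y`
    have hconst := const_on_block n M φ y (fun x' ν h1 h2 => by
      have hb : ¬ starReg n M S (x', ν) := by
        rintro (h' | h')
        · exact hy (by have : S (blockOf n M x') := h'; rwa [h1] at this)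
        · exact hy (by have : S (blockOf n M (x' + unitVec (fine n M) ν)) := h'; rwa [h2] at this)
      have e := hφ x' ν
      rw [hz, ext_apply_of_not _ _ hb, hh ν, add_zero] at e
      exact (sub_eq_zero.mp e.symm))
    -- its block average is that constant
    have havg : ψ y = φ (bpt n M y (fun _ => ⟨0, Nat.pos_of_ne_zero (NeZero.ne n)⟩)) := by
      rw [hψ, QsOp_mulVec]
      simp_rw [hconst]
      rw [Finset.sum_const, Finset.card_univ, Fintype.card_fun, Fintype.card_fin, Fintype.card_fin, nsmul_eq_mul]
      push_cast
      field_simp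
    -- hence `θ x = φ x − ψ y = 0`
    have ex : φ x = φ (bpt n M y (fun _ => ⟨0, Nat.pos_of_ne_zero (NeZero.ne n)⟩)) := by
      conv_lhs => rw [← bpt_blockOf_digits n M x]
      exact hconst (digits n M x)
    simp only [hθ, hψt]
    rw [ex, ← havg, sub_self]
  -- (9) the gauge parameter
  refine ⟨fun x => (n : ℂ)⁻¹ * θ x, ?_, ?_⟩
  · -- `Q′λ = 0` on the blocks of `S`: `Q′θ = ψ − Q′ψ̃ = 0`
    have hext : ext (blockReg n M S) (fun x : {x // blockReg n M S x} => (n : ℂ)⁻¹ * θ x) = fun x => (n : ℂ)⁻¹ * θ x := by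
      funext x
      by_cases hx : blockReg n M S x
      · exact ext_apply_of (blockReg n M S) _ ⟨x, hx⟩
      · rw [ext_apply_of_not _ _ hx, hθ0 x hx, mul_zero]
    funext y
    unfold QOm
    rw [toBlock_mulVec', hext, Pi.zero_apply]
    show (QsOp n M *ᵥ fun x => (n : ℂ)⁻¹ * θ x) (y : Tor M) = 0
    rw [QsOp_mulVec]
    have e1 : ∑ j : Fin d → Fin n, (n : ℂ)⁻¹ * θ (bpt n M y j)
        = (n : ℂ)⁻¹ * (∑ j : Fin d → Fin n, φ (bpt n M y j) - ∑ j : Fin d → Fin n, ψ y) := by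
      rw [← Finset.mul_sum, ← Finset.sum_sub_distrib]
      refine congrArg _ (Finset.sum_congr rfl fun j _ => ?_)
      simp only [hθ, hψt, blockOf_bpt]
    have e2 : ∑ j : Fin d → Fin n, φ (bpt n M y j) = (n : ℂ) ^ d * ψ y := by
      rw [hψ, QsOp_mulVec]; field_simp
    rw [e1, e2, Finset.sum_const, Finset.card_univ, Fintype.card_fun, Fintype.card_fin, Fintype.card_fin, nsmul_eq_mul]
    push_cast
    ring
  · -- `A = gradR λ`
    funext b
    have hb : A b = z b := (ext_apply_of (starReg n M S) A b).symm
    unfold gradR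
    rw [toBlock_mulVec', hb]
    have hext : ext (blockReg n M S) (fun x : {x // blockReg n M S x} => (n : ℂ)⁻¹ * θ x) = fun x => (n : ℂ)⁻¹ * θ x := by
      funext x
      by_cases hx : blockReg n M S x
      · exact ext_apply_of (blockReg n M S) _ ⟨x, hx⟩
      · rw [ext_apply_of_not _ _ hx, hθ0 x hx, mul_zero]
    rw [hext]
    obtain ⟨⟨x, μ⟩, hbV⟩ := b
    show z (x, μ) = (GradOp (fine n M) (n : ℂ) *ᵥ fun x => (n : ℂ)⁻¹ * θ x) (x, μ)
    rw [GradOp_mulVec, sdiff_mulVec, hzθ]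
    field_simp

/-! ## §4 «G(Ω₀) exists» for the faithful `U = 1` operator on every union of unit blocks -/

/-- **`Δ_a(Ω₀)` IS INVERTIBLE** for every decidable set `S` of unit blocks (`0 < a`, `0 < a′`): the positivity sentence of [B9] p.395 for
the `U = 1` gauge-fixed VECTOR operator (3.26)–(3.27), by file 1's reduction to the flatness lemma.  No bound on the inverse is claimed.
[cite: Balaban1985BackgroundPropagators, (3.27) p.395 (shape: existence of G)] [folklore] -/
theorem isUnit_det_regionDeltaA (ha : 0 < a) (ha' : 0 < a') : IsUnit (regionDeltaA n M a a' S).det := by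
  have hn : (0 : ℝ) < (n : ℝ) ^ d := pow_pos (by exact_mod_cast Nat.pos_of_ne_zero (NeZero.ne n)) d
  exact isUnit_det_gaugeFixed_of_flat _ (sliceData_region n M a' S ha') (mul_pos ha hn)
    (fun A hC hQ => flat_region n M S A hC hQ)

end Summit.QuantumFields.BalabanUV.T4Continuum.RegionGaugeFixedVectorFlat

end
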